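import Summits.PneNP.PneNP.Theses.NegLimited
import Mathlib
import Literature.Computability.Complexity.PerfectMatchingApproximators

/-!
# Route NegLimited — the degree (Dirac) certifier is sound in jumbled bipartite graphs
(rung F-N1/p3, ROUND-5 §1)

Proves the route support item `DiracCertifierSound` (stmt-PneNP-20005, route PneNP/NegLimited) with
its explicit type: if `x ⊆ K_{m,m}` (edges `Fin m × Fin m`, left × right) is upper `(d,β)`-jumbled —
`e_x(S,T) ≤ d|S||T|/m + β√(|S||T|)` for all `S, T` — and every left and right vertex has degree
`≥ (1/2+θ)d`, then `x` contains a matching with at least `m - ⌈4β²m/(θ²d²)⌉` edges.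

Proof (elementary, half a page on paper): (A) `stepA` — for `|S| ≥ s₀ := 4β²m/(θ²d²)` the two
inequalities `(1/2+θ)d|S| ≤ e_x(S,N(S)) ≤ d|S||N(S)|/m + β√(|S||N(S)|)` force `|N(S)| ≥ (1/2+θ/2)m`
(and symmetrically on the right); (B) hence `|N(S)| + ⌈s₀⌉ ≥ |S|` for every `S` (three cases: small
`S`; medium `S` by (A); large `S` by (A) applied to the non-neighbours of `S` on the right);
(C) Hall's marriage theorem [cite: Hall1935Representatives] (Mathlib
`Finset.all_card_le_biUnion_card_iff_exists_injective`) with `⌈s₀⌉` dummy right vertices.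
This is the deterministic defect form of the easy direction of local resilience of perfect
matchings (threshold `1/2`; Sudakov–Vu, arXiv:0706.4104, Thm 3.1). Why it is on the route: with
`β = 3√d` the AND of the `2m` degree thresholds `⌈(1/2+θ)d⌉` is a monotone circuit of size `≤ m³`
that is sound against matching deficiency `⌈36m/(θ²d)⌉` in every upper `(d,3√d)`-jumbled host —
it refutes the relative-density-`1/2` certification question `Q_rel` of ROUND-4 §7.6 and pins the
residue of the door crux `NeglimitedEpsLogNegationsR` (stmt-PneNP-19860) to certification
thresholds `c < 1/2` (cell record: HOME/pnp-ideate-p3/ROUND-5.md, Sketch-R5.lean).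
The by-name closer `diracCertifierSound_holds : NegLimited.DiracCertifierSound` is ONE line once the
gate re-renders `Theses/NegLimited.lean` with the item (see LANDING.md row 11).
-/

set_option linter.dupNamespace false -- `Summit.PneNP.PneNP.…`: summit = sub-problem name (D-0017 single-conjunct layout)

namespace Summit.PneNP.PneNP.Theorems.NegLimDirac

open Finset
open Literature.Computability.Complexity Literature.Computability.Complexity.PerfectMatching

variable {m : ℕ}

/-- Degree-sum lower bound on the number of edges leaving a set of left vertices. -/
theorem deg_sum_left (x : Finset (Fin m × Fin m)) (S : Finset (Fin m)) (δ : ℝ)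
    (h : ∀ u ∈ S, δ ≤ ((x.filter fun e => e.1 = u).card : ℝ)) :
    δ * S.card ≤ ((x.filter fun e => e.1 ∈ S).card : ℝ) := by
  have hfib := Finset.card_eq_sum_card_fiberwise (s := x.filter fun e => e.1 ∈ S) (t := S)
    (f := Prod.fst) (fun e he => (mem_filter.1 he).2)
  have hf : ∀ u ∈ S, ((x.filter fun e => e.1 ∈ S).filter fun e => e.1 = u) =
      x.filter fun e => e.1 = u := by
    intro u hu
    rw [filter_filter]
    exact filter_congr fun e _ => ⟨fun h => h.2, fun h => ⟨h ▸ hu, h⟩⟩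
  calc δ * S.card = ∑ _u ∈ S, δ := by rw [sum_const, nsmul_eq_mul, mul_comm]
    _ ≤ ∑ u ∈ S, ((x.filter fun e => e.1 = u).card : ℝ) := sum_le_sum h
    _ = ((x.filter fun e => e.1 ∈ S).card : ℝ) := by
        rw [hfib]; push_cast
        exact sum_congr rfl fun u hu => by rw [hf u hu]

/-- Degree-sum lower bound on the number of edges entering a set of right vertices. -/
theorem deg_sum_right (x : Finset (Fin m × Fin m)) (T : Finset (Fin m)) (δ : ℝ)
    (h : ∀ v ∈ T, δ ≤ ((x.filter fun e => e.2 = v).card : ℝ)) :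
    δ * T.card ≤ ((x.filter fun e => e.2 ∈ T).card : ℝ) := by
  have hfib := Finset.card_eq_sum_card_fiberwise (s := x.filter fun e => e.2 ∈ T) (t := T)
    (f := Prod.snd) (fun e he => (mem_filter.1 he).2)
  have hf : ∀ v ∈ T, ((x.filter fun e => e.2 ∈ T).filter fun e => e.2 = v) =
      x.filter fun e => e.2 = v := by
    intro v hv
    rw [filter_filter]
    exact filter_congr fun e _ => ⟨fun h => h.2, fun h => ⟨h ▸ hv, h⟩⟩
  calc δ * T.card = ∑ _v ∈ T, δ := by rw [sum_const, nsmul_eq_mul, mul_comm]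
    _ ≤ ∑ v ∈ T, ((x.filter fun e => e.2 = v).card : ℝ) := sum_le_sum h
    _ = ((x.filter fun e => e.2 ∈ T).card : ℝ) := by
        rw [hfib]; push_cast
        exact sum_congr rfl fun v hv => by rw [hf v hv]

/-- The real-arithmetic heart (step A): a set `S` of size `s ≥ 4β²m/(θ²d²)` sending `e ≥ (1/2+θ)ds`
edges into a set `T` of size `t`, in an upper `(d,β)`-jumbled graph, forces `t ≥ (1/2+θ/2)m`. -/
theorem stepA {m : ℕ} (hm : 0 < m) {θ d β : ℝ} (hθ : 0 < θ) (hd : 0 < d) (hβ : 0 ≤ β)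
    {s t e : ℝ} (htm : t ≤ m) (hs : 4 * β ^ 2 * m / (θ ^ 2 * d ^ 2) ≤ s)
    (hs0 : 0 < s) (hlo : (1 / 2 + θ) * d * s ≤ e)
    (hup : e ≤ d * s * t / m + β * Real.sqrt (s * t)) :
    (1 / 2 + θ / 2) * m ≤ t := by
  by_contra hcon
  push Not at hcon
  have hm' : (0 : ℝ) < m := by exact_mod_cast hm
  have hpos : 0 < θ ^ 2 * d ^ 2 := by positivity
  have hs' : 4 * β ^ 2 * m ≤ s * (θ ^ 2 * d ^ 2) := (div_le_iff₀ hpos).1 hs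
  have hβst : β * Real.sqrt (s * t) ≤ θ * d * s / 2 := by
    have h2 : β ^ 2 * (s * t) ≤ (θ * d * s / 2) ^ 2 := by
      have hst : s * t ≤ s * m := mul_le_mul_of_nonneg_left htm hs0.le
      have hb2 : 0 ≤ β ^ 2 := sq_nonneg β
      calc β ^ 2 * (s * t) ≤ β ^ 2 * (s * m) := mul_le_mul_of_nonneg_left hst hb2
        _ = s * (β ^ 2 * m) := by ring
        _ ≤ s * (s * (θ ^ 2 * d ^ 2) / 4) := by
            apply mul_le_mul_of_nonneg_left _ hs0.le
            linarith
        _ = (θ * d * s / 2) ^ 2 := by ring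
    calc β * Real.sqrt (s * t) = Real.sqrt (β ^ 2 * (s * t)) := by
          rw [Real.sqrt_mul (sq_nonneg β), Real.sqrt_sq hβ]
      _ ≤ Real.sqrt ((θ * d * s / 2) ^ 2) := Real.sqrt_le_sqrt h2
      _ = θ * d * s / 2 := Real.sqrt_sq (by positivity)
  have h3 : d * s * t / m < d * s * (1 / 2 + θ / 2) := by
    rw [div_lt_iff₀ hm']
    have hds : 0 < d * s := mul_pos hd hs0
    nlinarith
  linarith

/-- **`DiracCertifierSound` (stmt-PneNP-20005, route PneNP/NegLimited) with its explicit type**: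
an upper `(d,β)`-jumbled bipartite graph on `Fin m ⊎ Fin m` with all degrees `≥ (1/2+θ)d` has a
matching with at least `m - ⌈4β²m/(θ²d²)⌉` edges. [cite: Hall1935Representatives] -/
theorem diracCertifierSound :
    ∀ (m : ℕ) (θ d β : ℝ), 0 < θ → 0 < d → 0 ≤ β → ∀ x : Finset (Fin m × Fin m),
      (∀ S T : Finset (Fin m), ((x.filter fun e => e.1 ∈ S ∧ e.2 ∈ T).card : ℝ)
          ≤ d * S.card * T.card / m + β * Real.sqrt (S.card * T.card)) →
      (∀ u : Fin m, (1 / 2 + θ) * d ≤ ((x.filter fun e => e.1 = u).card : ℝ)) →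
      (∀ v : Fin m, (1 / 2 + θ) * d ≤ ((x.filter fun e => e.2 = v).card : ℝ)) →
        ∃ D : Finset (Fin m × Fin m), D ⊆ x ∧
          Literature.Computability.Complexity.PerfectMatching.IsMatching D ∧
            m - ⌈4 * β ^ 2 * m / (θ ^ 2 * d ^ 2)⌉₊ ≤ D.card := by
  intro m θ d β hθ hd hβ x hJ hL hR
  -- the defect
  set D₀ : ℕ := ⌈4 * β ^ 2 * m / (θ ^ 2 * d ^ 2)⌉₊ with hD₀
  rcases Nat.eq_zero_or_pos m with hm0 | hm
  · subst hm0
    refine ⟨∅, empty_subset _, ?_, by simp⟩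
    constructor <;> simp
  have hm' : (0 : ℝ) < m := by exact_mod_cast hm
  have hs₀D₀ : 4 * β ^ 2 * m / (θ ^ 2 * d ^ 2) ≤ (D₀ : ℝ) := Nat.le_ceil _
  have card_le_m : ∀ A : Finset (Fin m), A.card ≤ m := fun A => by
    have := card_le_univ A; simpa [Fintype.card_fin] using this
  -- Step A, left version: a big `S` whose edges all land in `T` forces `|T| ≥ (1/2+θ/2)m`
  have bigL : ∀ S T : Finset (Fin m), D₀ ≤ S.card → S.Nonempty →
      (∀ e ∈ x, e.1 ∈ S → e.2 ∈ T) → (1 / 2 + θ / 2) * m ≤ (T.card : ℝ) := by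
    intro S T hSD hSne hST
    have hScard : 0 < S.card := card_pos.2 hSne
    have hsub : (x.filter fun e => e.1 ∈ S) ⊆ x.filter fun e => e.1 ∈ S ∧ e.2 ∈ T := by
      intro e he
      rw [mem_filter] at he ⊢
      exact ⟨he.1, he.2, hST e he.1 he.2⟩
    have hlo : (1 / 2 + θ) * d * S.card
        ≤ ((x.filter fun e => e.1 ∈ S ∧ e.2 ∈ T).card : ℝ) :=
      le_trans (deg_sum_left x S _ fun u _ => hL u) (by exact_mod_cast card_le_card hsub)
    exact stepA hm hθ hd hβ (by exact_mod_cast card_le_m T)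
      (le_trans hs₀D₀ (by exact_mod_cast hSD)) (by exact_mod_cast hScard) hlo (hJ S T)
  -- Step A, right version
  have bigR : ∀ T S : Finset (Fin m), D₀ ≤ T.card → T.Nonempty →
      (∀ e ∈ x, e.2 ∈ T → e.1 ∈ S) → (1 / 2 + θ / 2) * m ≤ (S.card : ℝ) := by
    intro T S hTD hTne hTS
    have hTcard : 0 < T.card := card_pos.2 hTne
    have hsub : (x.filter fun e => e.2 ∈ T) ⊆ x.filter fun e => e.1 ∈ S ∧ e.2 ∈ T := by
      intro e he
      rw [mem_filter] at he ⊢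
      exact ⟨he.1, hTS e he.1 he.2, he.2⟩
    have hlo : (1 / 2 + θ) * d * T.card
        ≤ ((x.filter fun e => e.1 ∈ S ∧ e.2 ∈ T).card : ℝ) :=
      le_trans (deg_sum_right x T _ fun v _ => hR v) (by exact_mod_cast card_le_card hsub)
    have hup : ((x.filter fun e => e.1 ∈ S ∧ e.2 ∈ T).card : ℝ)
        ≤ d * T.card * S.card / m + β * Real.sqrt (T.card * S.card) := by
      have h1 : d * (S.card : ℝ) * T.card / m = d * T.card * S.card / m := by ring
      have h2 : (S.card : ℝ) * T.card = T.card * S.card := by ring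
      rw [← h1, ← h2]; exact hJ S T
    exact stepA hm hθ hd hβ (by exact_mod_cast card_le_m S)
      (le_trans hs₀D₀ (by exact_mod_cast hTD)) (by exact_mod_cast hTcard) hlo hup
  -- Step B: the defect Hall condition `|S| ≤ |N(S)| + D₀`
  have hall : ∀ S : Finset (Fin m),
      S.card ≤ ((x.filter fun e => e.1 ∈ S).image Prod.snd).card + D₀ := by
    intro S
    set N : Finset (Fin m) := (x.filter fun e => e.1 ∈ S).image Prod.snd with hN
    have hNmem : ∀ e ∈ x, e.1 ∈ S → e.2 ∈ N := fun e he h1 =>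
      mem_image.2 ⟨e, mem_filter.2 ⟨he, h1⟩, rfl⟩
    by_cases h1 : S.card < D₀
    · omega
    push Not at h1
    rcases S.eq_empty_or_nonempty with hSe | hSne
    · simp [hSe]
    by_cases h2 : (S.card : ℝ) ≤ (1 / 2 + θ / 2) * m
    · have : (S.card : ℝ) ≤ N.card := le_trans h2 (bigL S N h1 hSne hNmem)
      have : S.card ≤ N.card := by exact_mod_cast this
      omega
    push Not at h2
    -- large `S`: the right vertices outside `N(S)` are fewer than `D₀`
    have hT'small : (univ \ N).card ≤ D₀ := by
      by_contra h3
      push Not at h3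
      have hT'ne : (univ \ N).Nonempty := card_pos.1 (by omega)
      have hmem : ∀ e ∈ x, e.2 ∈ univ \ N → e.1 ∈ univ \ S := by
        intro e he h2e
        rw [mem_sdiff] at h2e ⊢
        exact ⟨mem_univ _, fun h1e => h2e.2 (hNmem e he h1e)⟩
      have hbig := bigR (univ \ N) (univ \ S) h3.le hT'ne hmem
      rw [card_sdiff_of_subset (subset_univ S), card_univ, Fintype.card_fin,
        Nat.cast_sub (card_le_m S)] at hbig
      have hθm : 0 < θ * m := by positivity
      linarith
    have hT'card : (univ \ N).card = m - N.card := by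
      rw [card_sdiff_of_subset (subset_univ _), card_univ, Fintype.card_fin]
    have hSm := card_le_m S
    have hNm := card_le_m N
    omega
  -- Step C: Hall's marriage theorem with `D₀` dummy right vertices
  classical
  let t : Fin m → Finset (Fin m ⊕ Fin D₀) := fun u =>
    ((x.filter fun e => e.1 = u).image Prod.snd).map ⟨Sum.inl, Sum.inl_injective⟩ ∪
      (univ : Finset (Fin D₀)).map ⟨Sum.inr, Sum.inr_injective⟩
  have hallt : ∀ s : Finset (Fin m), s.card ≤ (s.biUnion t).card := by
    intro s
    rcases s.eq_empty_or_nonempty with hse | hsne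
    · simp [hse]
    set N : Finset (Fin m) := (x.filter fun e => e.1 ∈ s).image Prod.snd with hN
    have hsub : N.map ⟨Sum.inl, Sum.inl_injective⟩ ∪
        (univ : Finset (Fin D₀)).map ⟨Sum.inr, Sum.inr_injective⟩ ⊆ s.biUnion t := by
      intro a ha
      rw [mem_union] at ha
      rw [mem_biUnion]
      rcases ha with ha | ha
      · rw [mem_map] at ha
        obtain ⟨v, hv, rfl⟩ := ha
        obtain ⟨e, he, rfl⟩ := mem_image.1 hv
        rw [mem_filter] at he
        refine ⟨e.1, he.2, ?_⟩
        simp only [t, mem_union, mem_map, mem_image, mem_filter, Function.Embedding.coeFn_mk]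
        left
        exact ⟨e.2, ⟨e, ⟨he.1, rfl⟩, rfl⟩, rfl⟩
      · obtain ⟨u, hu⟩ := hsne
        refine ⟨u, hu, ?_⟩
        simp only [t, mem_union]
        right; exact ha
    have hdisj : Disjoint (N.map ⟨Sum.inl, Sum.inl_injective⟩)
        ((univ : Finset (Fin D₀)).map ⟨Sum.inr, Sum.inr_injective⟩) := by
      rw [disjoint_left]
      intro a ha hb
      rw [mem_map] at ha hb
      obtain ⟨v, _, rfl⟩ := ha
      obtain ⟨k, _, hk⟩ := hb
      simp at hk
    have hcard : (N.map ⟨Sum.inl, Sum.inl_injective⟩ ∪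
        (univ : Finset (Fin D₀)).map ⟨Sum.inr, Sum.inr_injective⟩).card = N.card + D₀ := by
      rw [card_union_of_disjoint hdisj, card_map, card_map, card_univ, Fintype.card_fin]
    calc s.card ≤ N.card + D₀ := hall s
      _ = _ := hcard.symm
      _ ≤ (s.biUnion t).card := card_le_card hsub
  obtain ⟨f, hfinj, hft⟩ := (Finset.all_card_le_biUnion_card_iff_exists_injective t).1 hallt
  -- the matching: the edges `(u, v)` with `f u = inl v`
  let M : Finset (Fin m × Fin m) := x.filter fun e => f e.1 = Sum.inl e.2
  have hMx : M ⊆ x := filter_subset _ _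
  -- what `f u ∈ t u` says when `f u` is a genuine right vertex
  have hfmem : ∀ u v, f u = Sum.inl v → (u, v) ∈ x := by
    intro u v huv
    have := hft u
    rw [huv] at this
    simp only [t, mem_union, mem_map, mem_image, mem_filter, Function.Embedding.coeFn_mk,
      mem_univ, true_and] at this
    rcases this with ⟨w, ⟨e, ⟨hex, he1⟩, hew⟩, hw⟩ | ⟨k, hk⟩
    · have hwv : w = v := Sum.inl_injective hw
      subst hwv
      rw [← hew, ← he1]
      exact hex
    · simp at hk
  refine ⟨M, hMx, ?_, ?_⟩
  · -- `M` is a matching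
    constructor
    · intro e₁ he₁ e₂ he₂ h12
      rw [mem_filter] at he₁ he₂
      have : Sum.inl e₁.2 = (Sum.inl e₂.2 : Fin m ⊕ Fin D₀) := by
        rw [← he₁.2, ← he₂.2, h12]
      exact Prod.ext h12 (Sum.inl_injective this)
    · intro e₁ he₁ e₂ he₂ h12
      rw [mem_filter] at he₁ he₂
      have : f e₁.1 = f e₂.1 := by rw [he₁.2, he₂.2, h12]
      exact Prod.ext (hfinj this) h12
  · -- size: the left vertices matched by `f` to genuine right vertices inject into `M`
    let U' : Finset (Fin m) := univ.filter fun u => ∃ v, f u = Sum.inl v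
    let U'' : Finset (Fin m) := univ.filter fun u => ¬ ∃ v, f u = Sum.inl v
    have hpart : U'.card + U''.card = m := by
      have := card_filter_add_card_filter_not (s := (univ : Finset (Fin m)))
        (fun u => ∃ v, f u = Sum.inl v)
      simpa [U', U'', Fintype.card_fin] using this
    have hU'' : U''.card ≤ D₀ := by
      have hmaps : Set.MapsTo f (U'' : Set (Fin m))
          (((univ : Finset (Fin D₀)).map ⟨Sum.inr, Sum.inr_injective⟩ :
            Finset (Fin m ⊕ Fin D₀)) : Set (Fin m ⊕ Fin D₀)) := by
        intro u hu
        have hu' : ¬ ∃ v, f u = Sum.inl v := by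
          have := hu
          simp only [U'', coe_filter, Set.mem_setOf_eq, mem_univ, true_and] at this
          exact this
        rcases hfu : f u with v | k
        · exact absurd ⟨v, hfu⟩ hu'
        · simp
      have := card_le_card_of_injOn f hmaps hfinj.injOn
      rwa [card_map, card_univ, Fintype.card_fin] at this
    have hU'M : U'.card ≤ M.card := by
      let g : Fin m → Fin m × Fin m := fun u => (u, Sum.elim id (fun _ => u) (f u))
      have hmaps : Set.MapsTo g (U' : Set (Fin m)) (M : Set (Fin m × Fin m)) := by
        intro u hu
        have hu' : ∃ v, f u = Sum.inl v := by
          have := hu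
          simp only [U', coe_filter, Set.mem_setOf_eq, mem_univ, true_and] at this
          exact this
        obtain ⟨v, hv⟩ := hu'
        have hg : g u = (u, v) := by simp [g, hv]
        rw [mem_coe, hg, mem_filter]
        exact ⟨hfmem u v hv, hv⟩
      have hinj : Set.InjOn g (U' : Set (Fin m)) := by
        intro u _ u' _ h
        have := congrArg Prod.fst h
        simpa [g] using this
      exact card_le_card_of_injOn g hmaps hinj
    omega

end Summit.PneNP.PneNP.Theorems.NegLimDirac

namespace Summit.PneNP.PneNP.Theorems

/-- **stmt-PneNP-20005 (`NegLimited.DiracCertifierSound`) PROVED, by name.**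
[cite: Hall1935Representatives] -/
theorem diracCertifierSound_holds :
    Summit.PneNP.PneNP.Theses.NegLimited.DiracCertifierSound :=
  NegLimDirac.diracCertifierSound

end Summit.PneNP.PneNP.Theorems
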